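import Summits.ResolutionOfSingularities.ResolutionOfSingularities.Theorems.FrobeniusClosingPatchingRelPerfectDepthParamLiftFlat
import HarnessLib

/-!
# Crux `PatchingRelPerfect` (stmt-ResolutionOfSingularities-16161), chain W5.2 — F7(β) d = 2 (β-AX), X2a module 2 (M2c), e-chart algebra I:
# PARAM-LIFT data lift from the quotients by a matched regular parameter

[OURS · L1 W5.2 · F7(β) (β-AX) X-side · res-D-pv-034 AS res-L1-s36-pv-3 per res-L1-w52-plan-1 RULING G11-21 ((M2c) PARAM
PROPAGATION, e-chart half).]  Replaces the role of NO printed item; NOT a statement of the manuscript under review; fact-free,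
def-free.  AI-written; AI review is weaker than expert review.

The e-chart point `y′` of the lifted retraction `r′ : V′ → Z′` over the centre has local rings `S_A = 𝒪_{Z′,z′} = A[𝔞/aᵢ]_𝔮`,
`S_B = 𝒪_{V′,y′} = B[𝔟/eᵢ]_𝔔` (`𝔟 = (t) + 𝔞B`, `eᵢ = σ aᵢ`), and `r′^♯(aᵢ) = eᵢ` generates both exceptional ideals.  Modulo the
matched regular parameter `aᵢ ↦ eᵢ` the map becomes `(A/𝔞)[T̂ᵢ]_𝔮̄ → (A/𝔞)[T̂ᵢ][T_t]_𝔔̄` (one polynomial variable adjoined, then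
localised), where PARAM-LIFT data come from flatness with a regular one-dimensional fibre.  This file PROVES the algebra that
lifts such data back through the matched parameter:

* `spanFinrank_maximalIdeal_eq_quotient_add_one` — for a regular local ring `S` and `g ≠ 0` in `𝔪_S` with `S/(g)` regular:
  `emb dim S = emb dim S/(g) + 1`.
* **`exists_finset_sup_span_eq_maximalIdeal_of_quotient`** — `f : S → S′` a local homomorphism of regular local rings, `g ∈ 𝔪_S`
  with `g ≠ 0`, `f g ≠ 0`, both quotients `S/(g)`, `S′/(f g)` regular; PARAM-LIFT data for the induced map of the quotients
  (`Ideal.quotientMap`) lift to PARAM-LIFT data for `f` (lift the extra parameters; the counts shift by one on both sides).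

## References
* H. Matsumura, *Commutative Ring Theory* (1986), Thm. 14.2, Thm. 23.7. [Matsumura1987]
-/

-- `Summit.<Summit>.<Sub>.Theorems` with `Sub = Summit` (single-conjunct summit, D-0017)
set_option linter.dupNamespace false

noncomputable section

open IsLocalRing
open Literature.AlgebraicGeometry.Resolution

namespace Summit.ResolutionOfSingularities.ResolutionOfSingularities.Theorems.DepthMultiHost

universe u

/-- **`emb dim S = emb dim S/(g) + 1`** for a regular local ring `S`, `g ≠ 0` in `𝔪_S`, with `S/(g)` regular (both embedding
dimensions are Krull dimensions, and `dim S/(g) + 1 = dim S`). [cite: Matsumura1987, Thm. 14.2] -/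
theorem spanFinrank_maximalIdeal_eq_quotient_add_one {S : Type u} [CommRing S] [IsRegularLocalRing S] {g : S}
    (hg : g ∈ maximalIdeal S) (hg0 : g ≠ 0) [hq : IsRegularLocalRing (S ⧸ Ideal.span {g})] :
    (maximalIdeal S).spanFinrank = (maximalIdeal (S ⧸ Ideal.span {g})).spanFinrank + 1 := by
  haveI : IsDomain S := isDomain_of_isRegularLocalRing S
  have hdim := ringKrullDim_quotient_span_singleton_succ_eq_ringKrullDim_of_mem_nonZeroDivisors
    (mem_nonZeroDivisors_of_ne_zero hg0) hg
  have hS := IsRegularLocalRing.spanFinrank_maximalIdeal (R := S)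
  have hQ := IsRegularLocalRing.spanFinrank_maximalIdeal (R := S ⧸ Ideal.span {g})
  rw [← hdim, ← hQ] at hS
  have h : ((maximalIdeal S).spanFinrank : WithBot ℕ∞) =
      (((maximalIdeal (S ⧸ Ideal.span {g})).spanFinrank + 1 : ℕ) : WithBot ℕ∞) := by
    rw [hS]; push_cast; rfl
  exact_mod_cast h

/-- [OURS · L1 W5.2 · F7(β) (β-AX) M2c] **PARAM-LIFT data lift from the quotients by a matched regular parameter.**  Let
`f : S → S′` be a local homomorphism of regular local rings and `g ∈ 𝔪_S` with `g ≠ 0`, `f g ≠ 0` and both `S/(g)`, `S′/(f g)`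
regular.  If the induced `f̄ : S/(g) → S′/(f g)` admits `s̄` with `𝔪_{S/(g)} · S′/(f g) ⊔ (s̄) = 𝔪_{S′/(f g)}` and
`#s̄ + emb dim S/(g) = emb dim S′/(f g)`, then `f` admits `s` (lifts of `s̄`) with `𝔪_S S′ ⊔ (s) = 𝔪_{S′}` and
`#s + emb dim S = emb dim S′`. [cite: Matsumura1987, Thm. 14.2] -/
theorem exists_finset_sup_span_eq_maximalIdeal_of_quotient {S S' : Type u} [CommRing S] [CommRing S'] [IsRegularLocalRing S]
    [IsRegularLocalRing S'] (f : S →+* S') [IsLocalHom f] {g : S} (hg : g ∈ maximalIdeal S) (hg0 : g ≠ 0) (hfg0 : f g ≠ 0)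
    [IsRegularLocalRing (S ⧸ Ideal.span {g})] [IsRegularLocalRing (S' ⧸ Ideal.span {f g})]
    (hle : Ideal.span {g} ≤ (Ideal.span {f g}).comap f)
    (h : ∃ sq : Finset (S' ⧸ Ideal.span {f g}),
      (maximalIdeal (S ⧸ Ideal.span {g})).map (Ideal.quotientMap (Ideal.span {f g}) f hle) ⊔
          Ideal.span (sq : Set (S' ⧸ Ideal.span {f g})) = maximalIdeal (S' ⧸ Ideal.span {f g}) ∧
        sq.card + (maximalIdeal (S ⧸ Ideal.span {g})).spanFinrank = (maximalIdeal (S' ⧸ Ideal.span {f g})).spanFinrank) :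
    ∃ s : Finset S', (maximalIdeal S).map f ⊔ Ideal.span (s : Set S') = maximalIdeal S' ∧
      s.card + (maximalIdeal S).spanFinrank = (maximalIdeal S').spanFinrank := by
  classical
  obtain ⟨s₀, hs₀1, hs₀2⟩ := h
  have hπ's : Function.Surjective (Ideal.Quotient.mk (Ideal.span {f g})) := Ideal.Quotient.mk_surjective
  haveI : Nontrivial (S' ⧸ Ideal.span {f g}) := Ideal.Quotient.nontrivial_iff.mpr (by
    rw [Ne, Ideal.span_singleton_eq_top]; exact fun hu => (map_nonunit f g hg) hu)
  haveI : Nontrivial (S ⧸ Ideal.span {g}) := Ideal.Quotient.nontrivial_iff.mpr (by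
    rw [Ne, Ideal.span_singleton_eq_top]; exact hg)
  haveI := IsLocalHom.of_surjective (Ideal.Quotient.mk (Ideal.span {f g})) hπ's
  haveI := IsLocalHom.of_surjective (Ideal.Quotient.mk (Ideal.span {g})) Ideal.Quotient.mk_surjective
  have hfgm : f g ∈ maximalIdeal S' := map_nonunit f g hg
  -- lifts of the extra parameters
  choose lift hlift using fun x : S' ⧸ Ideal.span {f g} => hπ's x
  refine ⟨s₀.image lift, ?_, ?_⟩
  · apply le_antisymm
    · refine sup_le (map_maximalIdeal_le f) ?_
      rw [Ideal.span_le]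
      intro b hb
      obtain ⟨x, hx, rfl⟩ := Finset.mem_image.mp (Finset.mem_coe.mp hb)
      have hxm : x ∈ maximalIdeal (S' ⧸ Ideal.span {f g}) := by
        rw [← hs₀1]; exact Ideal.mem_sup_right (Submodule.subset_span (Finset.mem_coe.mpr hx))
      exact (map_mem_nonunits_iff (Ideal.Quotient.mk (Ideal.span {f g})) (lift x)).mp (by rw [hlift]; exact hxm)
    · intro b hb
      -- the class of `b` lies in `𝔪_{S/(g)} · S′/(f g) ⊔ (extra)`, which is the image of `𝔪_S S′ ⊔ (lifts)`
      have hb' : Ideal.Quotient.mk (Ideal.span {f g}) b ∈ maximalIdeal (S' ⧸ Ideal.span {f g}) :=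
        map_nonunit (Ideal.Quotient.mk (Ideal.span {f g})) b hb
      rw [← hs₀1] at hb'
      have hmax : (maximalIdeal (S ⧸ Ideal.span {g})).map (Ideal.quotientMap (Ideal.span {f g}) f hle) =
          ((maximalIdeal S).map f).map (Ideal.Quotient.mk (Ideal.span {f g})) := by
        rw [maximalIdeal_quotient_eq_map (Ideal.span {g}), Ideal.map_map, Ideal.map_map]
        congr 1
      have hspan : Ideal.span (s₀ : Set (S' ⧸ Ideal.span {f g})) =
          (Ideal.span ((s₀.image lift : Finset S') : Set S')).map (Ideal.Quotient.mk (Ideal.span {f g})) := by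
        rw [Ideal.map_span, Finset.coe_image, Set.image_image]
        congr 1; ext x; simp [hlift]
      rw [hmax, hspan, ← Ideal.map_sup, Ideal.mem_map_iff_of_surjective _ hπ's] at hb'
      obtain ⟨c, hc, hcb⟩ := hb'
      have hbc : b - c ∈ Ideal.span {f g} := by rw [← Ideal.Quotient.eq]; exact hcb.symm
      have hI'le : Ideal.span {f g} ≤ (maximalIdeal S).map f ⊔ Ideal.span ((s₀.image lift : Finset S') : Set S') := by
        rw [Ideal.span_singleton_le_iff_mem]
        exact Ideal.mem_sup_left (Ideal.mem_map_of_mem f hg)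
      have : b = (b - c) + c := by ring
      rw [this]
      exact Ideal.add_mem _ (hI'le hbc) hc
  · have hinj : Set.InjOn lift (s₀ : Set (S' ⧸ Ideal.span {f g})) := fun x _ y _ hxy => by
      rw [← hlift x, ← hlift y, hxy]
    rw [Finset.card_image_of_injOn hinj, spanFinrank_maximalIdeal_eq_quotient_add_one hg hg0,
      spanFinrank_maximalIdeal_eq_quotient_add_one hfgm hfg0, ← hs₀2]
    ring

end Summit.ResolutionOfSingularities.ResolutionOfSingularities.Theorems.DepthMultiHost

end
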